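import Summits.KontsevichZagierPeriods.Zeta5Search.WedgeDictionary
import Summits.KontsevichZagierPeriods.Zeta5Search.BigPrimeDivisibility
import HarnessLib

/-!
# ζ(5) search — OBSERVED valuation laws for the dual series `F̃₇(b)` (cell `pub-zeta5`; found by gen-2 g5, filed by typer g7)

HONEST FRAMING: systematic search; no irrationality claim unless certified.  Everything below is an OBSERVED
regularity (exact arithmetic on > 30,000 sampled `(b, p)` rows with `b₀ ≤ 64` and on all 66,130 rows of the 87 audited
cellular rays `b = n·b(a)`, 0 violations; evidence `HOME/pub-zeta5-gen-2/g5/runs/genb/*.json`, REPORT-gen2-g5 §5d–§5e),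
NOT a cited fact: the six `Prop`s are statements minted by this cell (tagged `@[conjecture]`); the last two, (W∞) and (U∞), have a
complete elementary PAPER PROOF (REPORT-gen2-g5 §5f) AND a Lean proof (typer g7, `Zeta5Search/BigPrimeDivisibility.lean`:
`BigPrime.one_le_padicValRat_coeffW / _coeffU`) — they are DISCHARGED at the end of this file (`BigPrimeDivisibility_holds`,
`BigPrimeDivisibilityU_holds`) and keep the `@[conjecture]` tag only as the record of how they were found; the first four remain OBSERVED.  They concern the CANONICAL coefficients `coeffW`, `coeffV` of `WedgeDictionary`
(`F̃₇(b) = U ζ(5) + W ζ(3) − V`) and say that the 2×2 minor `W(b+e_j)V(b) − W(b)V(b+e_j)` (whose multiple `ρ·(…)` is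
the constant term `P` of the cellular linear form under `wedgeDictionary`) has a denominator governed by the 21 pair
blocks `b₀ − b_i − b_k`, refunded by one prime factor whenever `p ≤ d(b) = 3b₀ − Σ b_i` (`dOf`), and that the
ζ(3)-coefficient alone is refunded, in addition, once for every long block through the least parameter.
On the rays these laws are the closed form of Brown–Zudilin's "denominator savings" (arXiv:2210.03391 §10) and imply
the cell's staircase law; see REPORT-gen2-g5 §4–§5e for the derivation and the scorecard.

SMALL PRIMES (exhaustive scan of the polytope for b₀ ≤ 10, 1,734 parameter vectors, 2026-08-20): every law below holds at p = 2, 5, 7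
without exception, but at p = 3 the refund over-claims by one exactly when the excess d ∈ {2,3,4} (37 W-cases, 24 Casoratian cases) —
consistent with the extra `1/3!` of the third Taylor coefficients; hence the hypothesis `5 ≤ p` throughout.  `W(b) = 0` occurred only at
d = 0 (4 cases), which is what the `≠ 0` guards are for.
-/

namespace Summit.KontsevichZagierPeriods.Zeta5Search.CasoratianValuation

open Finset
open Summit.KontsevichZagierPeriods.Zeta5Search.DualSeries (InBox)
open Summit.KontsevichZagierPeriods.Zeta5Search.WedgeDictionary (coeffU coeffW coeffV dOf)

/-- `Σ_{1 ≤ i < k ≤ 7} ⌊(b₀ − b_i − b_k)/p⌋` — one unit per multiple of `p` inside each of the 21 pair blocks. -/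
def pairFloors (b : ℕ → ℤ) (p : ℕ) : ℤ :=
  ∑ i ∈ range 7, ∑ k ∈ range 7, if i < k then (b 0 - b (i + 1) - b (k + 1)) / (p : ℤ) else 0

/-- The refund `min(1, ⌊d(b)/p⌋)`: one prime factor back as soon as `p ≤ d(b) = 3b₀ − Σ_i b_i`. -/
def refund (b : ℕ → ℤ) (p : ℕ) : ℤ := min 1 (dOf b / (p : ℤ))

/-- The refund for the ζ(3)-coefficient alone: `min(1, ⌊(d(b)+1)/p⌋)`; `d(b)+1 = 3b₀+1−Σbᵢ` is the Bailey excess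
`2 + 3a − (sum of the seven other parameters)` of the underlying very-well-poised series (a = b₀+2, parameters bⱼ+1). -/
def refundW (b : ℕ → ℤ) (p : ℕ) : ℤ := min 1 ((dOf b + 1) / (p : ℤ))

/-- The contiguous shift `b + e_j`. -/
def shift (b : ℕ → ℤ) (j : ℕ) : ℕ → ℤ := Function.update b j (b j + 1)

/-- The 2×2 minor ("Casoratian in the direction `e_j`") of the (ζ(3), constant) coefficients. -/
noncomputable def casoratian (b : ℕ → ℤ) (j : ℕ) : ℚ :=
  coeffW (shift b j) * coeffV b - coeffW b * coeffV (shift b j)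

/-- The Brown–Zudilin polytope `0 ≤ 2b_i ≤ b₀` together with the convergence margin `Σ_i b_i ≤ 3b₀` (so that both
`F̃₇(b)` and `F̃₇(b+e_j)` converge). -/
def InPolytope (b : ℕ → ℤ) : Prop :=
  InBox b ∧ (∀ i ∈ range 7, 2 * b (i + 1) ≤ b 0) ∧ (∑ i ∈ range 7, b (i + 1)) ≤ 3 * b 0

/-- The least of the seven lower parameters. -/
noncomputable def bMin (b : ℕ → ℤ) : ℤ := ((range 7).image fun i => b (i + 1)).min' (by simp)

/-- `a_p(b) = #{k ≠ k₀ : b₀ − b_k − b_{k₀} ≥ p}`, `k₀` an index of the least parameter (choice-independent). -/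
noncomputable def topPartners (b : ℕ → ℤ) (p : ℕ) : ℤ :=
  (((range 7).filter fun i => (p : ℤ) ≤ b 0 - b (i + 1) - bMin b).card : ℤ)
    - (if (p : ℤ) ≤ b 0 - 2 * bMin b then 1 else 0)

/-- **(CV), OBSERVED.**  For `b` in the polytope, any contiguity index `j` keeping `b + e_j` in the polytope, and
every prime `p` with `p² > b₀ + 2`:  `v_p(W(b+e_j)V(b) − W(b)V(b+e_j)) ≥ min(1,⌊d(b)/p⌋) − Σ_{i<k} ⌊(b₀−b_i−b_k)/p⌋`
(the sharper observed form adds the 'full-star' unit `F_p(b)`; omitted here).  The guard `≠ 0` avoids the junk value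
`padicValRat p 0 = 0` where the bound forces divisibility. -/
@[conjecture] def CasoratianValuationLaw : Prop :=
  ∀ (b : ℕ → ℤ) (j p : ℕ), InPolytope b → 1 ≤ j → j ≤ 7 → InPolytope (shift b j) →
    p.Prime → 5 ≤ p → (b 0 + 2 : ℤ) < (p : ℤ) ^ 2 → casoratian b j ≠ 0 →
      refund b p - pairFloors b p ≤ padicValRat p (casoratian b j)

/-- **(WV), OBSERVED** (window sharpened 2026-08-20: the refund for `W` alone is `min(1,⌊(d+1)/p⌋)` — holds at `p = d+1` in 457/457 sampled cases, fails at `p = d+2` in 139/139).  For `b` in the polytope and EVERY prime `p`: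
`v_p(W(b)) ≥ min(1,⌊(d(b)+1)/p⌋) + a_p(b) − Σ_{i<k} ⌊(b₀−b_i−b_k)/p⌋`. -/
@[conjecture] def Zeta3CoefficientValuationLaw : Prop :=
  ∀ (b : ℕ → ℤ) (p : ℕ), InPolytope b → p.Prime → 5 ≤ p → coeffW b ≠ 0 →
    refundW b p + topPartners b p - pairFloors b p ≤ padicValRat p (coeffW b)


/-- The minor of the (ζ(5), ζ(3)) coefficients in the direction `e_j` (its multiple `ρ·(…)` is `Q` under `wedgeDictionary`). -/
noncomputable def minorQ (b : ℕ → ℤ) (j : ℕ) : ℚ :=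
  coeffU b * coeffW (shift b j) - coeffU (shift b j) * coeffW b

/-- The minor of the (ζ(5), constant) coefficients in the direction `e_j` (its multiple `ρ·(…)` is `P̂`). -/
noncomputable def minorPhat (b : ℕ → ℤ) (j : ℕ) : ℚ :=
  coeffU b * coeffV (shift b j) - coeffU (shift b j) * coeffV b

/-- **(QV), OBSERVED** (0 violations in 10,302 sampled rows at ALL primes and in 66,130 ray rows):
`v_p(U(b)W(b+e_j) − U(b+e_j)W(b)) ≥ min(1,⌊d(b)/p⌋) − Σ_{i<k} ⌊(b₀−b_i−b_k)/p⌋`. -/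
@[conjecture] def QMinorValuationLaw : Prop :=
  ∀ (b : ℕ → ℤ) (j p : ℕ), InPolytope b → 1 ≤ j → j ≤ 7 → InPolytope (shift b j) →
    p.Prime → 5 ≤ p → minorQ b j ≠ 0 →
      refund b p - pairFloors b p ≤ padicValRat p (minorQ b j)

/-- **(P̂V), OBSERVED** (0 violations in 7,351 sampled rows with `p² > b₀+2` and in 66,130 ray rows; the form without
the extra `−1` FAILS in 2,097 of them): `v_p(U(b)V(b+e_j) − U(b+e_j)V(b)) ≥ min(1,⌊d(b)/p⌋) − 1 − Σ_{i<k} ⌊(b₀−b_i−b_k)/p⌋`. -/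
@[conjecture] def PhatMinorValuationLaw : Prop :=
  ∀ (b : ℕ → ℤ) (j p : ℕ), InPolytope b → 1 ≤ j → j ≤ 7 → InPolytope (shift b j) →
    p.Prime → 5 ≤ p → (b 0 + 2 : ℤ) < (p : ℤ) ^ 2 → minorPhat b j ≠ 0 →
      refund b p - 1 - pairFloors b p ≤ padicValRat p (minorPhat b j)

/-- **(W∞) big-prime divisibility — PROVED ON PAPER** (REPORT-gen2-g5 §5f, 2026-08-20; formalisation pending, hence still tagged
`@[conjecture]` here).  For `b` in the polytope and every prime `p` with `max(7, b₀+1) ≤ p ≤ d(b) + 1 = 3b₀ + 1 − Σ bᵢ` (the Bailey excess),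
`p ∣ W(b)`.  Proof sketch: all partial-fraction coefficients `A_{k,s}` are `p`-integral; the Wilson identity `∏_{u ∈ 𝔽_p^×}(ε+u) = ε^{p−1} − 1`
gives `1/∏_{i∈B}(t+i) ≡ −ε⁻¹ ∏_{i∈𝔽_p∖B}(t+i)` at every pole `t = −k+ε`, so `A_{k,s} ≡ −M_b^{(7−s)}(−k)/(7−s)!` with the POLYNOMIAL
`M_b(t) = (2t+b₀+2)(t+1)_{b₀+1} ∏_j ∏_{i∉B_j}(t+i)` of degree `7p − 6b₀ − 5 + 2Σbⱼ`; `M_b` vanishes to order 7 off the poles, so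
`W = Σ_k A_{k,3} ≡ −(1/24) Σ_{x∈𝔽_p} M_b⁽⁴⁾(x)`, and `Σ_{x∈𝔽_p} (x^m)⁽⁴⁾ ≡ 0` unless `m ≥ 5p − 1`; finally `deg M_b ≤ 5p − 2 ⟺ p ≤ d+1`.
(Every step machine-checked on random data: 4,182 pointwise congruences, 364 sum congruences inside and outside the window, 0 failures;
`p = 5` — only `b₀ ≤ 4` — is ALSO covered by the argument: the `ε^{p−1}`-correction at `p = 5`, `s = 3` multiplies `[ε⁰]M_b(−k+ε) = M_b(−k) = 0`,
so the statement below carries `5 ≤ p` without a computational supplement; typer g7.)  The earlier sampled evidence: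
0 exceptions in 4,253 + 220 `(b, j, p)` rows with `b₀ ≤ 120`. -/
@[conjecture] def BigPrimeDivisibility : Prop :=
  ∀ (b : ℕ → ℤ) (p : ℕ), InPolytope b → p.Prime → 5 ≤ p → b 0 + 1 ≤ (p : ℤ) → (p : ℤ) ≤ dOf b + 1 → coeffW b ≠ 0 →
    1 ≤ padicValRat p (coeffW b)

/-- **(U∞) — PROVED ON PAPER with (W∞)** (same argument with the second derivative: `U = Σ_k A_{k,5} ≡ −(1/2) Σ_{x∈𝔽_p} M_b''(x)`, which
vanishes for `deg M_b ≤ 3p − 2 ⟺ 2p ≤ d+1`): every prime `p` with `max(5, b₀+1) ≤ p` and `2p ≤ d(b)+1` divides the ζ(5)-coefficient `U(b)`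
(prediction made by the proof and then confirmed: 26/26 sampled cases; e.g. `b = (10;0⁷)`: `11·13 ∣ num U`, `17 ∤`). -/
@[conjecture] def BigPrimeDivisibilityU : Prop :=
  ∀ (b : ℕ → ℤ) (p : ℕ), InPolytope b → p.Prime → 5 ≤ p → b 0 + 1 ≤ (p : ℤ) → 2 * (p : ℤ) ≤ dOf b + 1 → coeffU b ≠ 0 →
    1 ≤ padicValRat p (coeffU b)

/-! ### (W∞) and (U∞) are theorems -/

/-- **(W∞) is a theorem** (gen-2 g5's paper proof, REPORT-gen2-g5 §5f; Lean proof typer g7,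
`BigPrime.one_le_padicValRat_coeffW`): every prime `max(5, b₀+1) ≤ p ≤ d(b)+1` divides the ζ(3)-coefficient `W(b)`. -/
theorem BigPrimeDivisibility_holds : BigPrimeDivisibility :=
  fun b p hb hp hp5 hpb hpd hW => BigPrime.one_le_padicValRat_coeffW b p hb.1 hb.2.1 hb.2.2 hp hp5 hpb hpd hW

/-- **(U∞) is a theorem** (`BigPrime.one_le_padicValRat_coeffU`): every prime `p ≥ max(5, b₀+1)` with `2p ≤ d(b)+1`
divides the ζ(5)-coefficient `U(b)`. -/
theorem BigPrimeDivisibilityU_holds : BigPrimeDivisibilityU :=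
  fun b p hb hp hp5 hpb hpd hU => BigPrime.one_le_padicValRat_coeffU b p hb.1 hb.2.1 hb.2.2 hp hp5 hpb hpd hU

end Summit.KontsevichZagierPeriods.Zeta5Search.CasoratianValuation
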